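import Literature.Computability.Complexity.SymmetricThresholdPrograms
import HarnessLib

/-!
# Symmetric threshold programs: the relabelled-matrix readout gadget

A reusable GADGET for symmetric threshold programs over MATRIX inputs `x : Fin m × Fin m → Bool`
(`SymProg`, `SymmetricThresholdPrograms.lean`).  A canonisation circuit for the window
`W ⊆ Fin m` (route `PneNP/SymmetryBudget`, item `NoHiddenOrder`) produces, for every label `ℓ`,
POSITION wires `pos ℓ u j` ("vertex `u ∈ W` is placed at position `j ∈ W`"); the canonical form it
must output is the relabelled matrix `(a, b) ↦ x (π⁻¹ a, π⁻¹ b)` for the permutation `π` of `Fin m`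
encoded by the position wires (the identity off `W`).  The readout gadget computes that matrix
from the position wires with two layers of gates,
`cell ℓ u v a b = x(u,v) ∧ [a ∈ W → pos ℓ u a] ∧ [b ∈ W → pos ℓ v b]` and
`entry ℓ a b = ∃ u ∈ cand a, v ∈ cand b, cell ℓ u v a b` (`cand a = W` for `a ∈ W`, `{a}` otherwise):

* `Readout.sem_entry_of_encodes` — if the position wires of `ℓ` encode a permutation `π` that is
  the identity off `W` (`Readout.Encodes`), then `entry ℓ a b` carries `x (π⁻¹ a, π⁻¹ b)`.

Positions are NOT permuted by the symmetries of the ambient program (only labels and vertices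
are), so the entries are legitimate fixed outputs / lex-min values (`SymmetricThresholdProgramsLexMin.lean`).
Gate count `O(|L|·m²·|W|²)`.

## References
* M. Anderson, A. Dawar, *On symmetric circuits and fixed-point logics*, Theory Comput. Syst. 60
  (2017), §3 [AndersonDawar2016].
-/

namespace Literature.Computability.Complexity

open Finset

namespace SymProg

variable {Λ : Type*} [DecidableEq Λ] {m : ℕ} (P : SymProg (Fin m × Fin m) Λ)
variable (L : Type*) (W : Finset (Fin m))

/-- The candidate vertices for position `a`: all of `W` if `a ∈ W`, else `a` itself. [folklore] -/
def cand (a : Fin m) : Finset (Fin m) := if a ∈ W then W else {a}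

/-- Membership in `cand`. [folklore] -/
theorem mem_cand_iff {W : Finset (Fin m)} {a u : Fin m} :
    u ∈ cand W a ↔ (a ∈ W ∧ u ∈ W) ∨ (a ∉ W ∧ u = a) := by
  unfold cand; split_ifs with h <;> simp [h]

/-- **The relabelled-matrix readout gadget** inside `P`, for labels `L` and window `W`: the
position wires it reads, the gates `cell`, `entry`, and their equations in `P`.
[cite: AndersonDawar2016, §3] -/
structure Readout where
  /-- position wire: vertex `u` is placed at position `j` (read for `u, j ∈ W` only) -/
  pos : L → Fin m → Fin m → (Fin m × Fin m) ⊕ Λ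
  /-- `cell ℓ u v a b`: `x (u, v)`, and `u` is at `a` (if `a ∈ W`), and `v` is at `b` (if `b ∈ W`) -/
  cell : L → Fin m → Fin m → Fin m → Fin m → Λ
  /-- `entry ℓ a b`: the entry `(a, b)` of the relabelled matrix of `ℓ` -/
  entry : L → Fin m → Fin m → Λ
  kind_cell : ∀ ℓ u v a b, P.kind (cell ℓ u v a b) = Kind.and
  srcs_cell : ∀ ℓ u v a b, P.srcs (cell ℓ u v a b) =
    insert (Sum.inl (u, v)) ((if a ∈ W then {pos ℓ u a} else ∅) ∪ (if b ∈ W then {pos ℓ v b} else ∅))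
  kind_entry : ∀ ℓ a b, P.kind (entry ℓ a b) = Kind.or
  srcs_entry : ∀ ℓ a b, P.srcs (entry ℓ a b) =
    (cand W a ×ˢ cand W b).image fun uv => Sum.inr (cell ℓ uv.1 uv.2 a b)

namespace Readout

variable {P L W} (R : P.Readout L W) (x : Fin m × Fin m → Bool)

/-- The position wires of `ℓ` ENCODE the permutation `π` on input `x`: `π` is the identity off
`W`, and for `u, j ∈ W` the wire `pos ℓ u j` is true iff `π u = j`. [folklore] -/
structure Encodes (ℓ : L) (π : Equiv.Perm (Fin m)) : Prop where
  /-- `π` fixes every index outside the window -/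
  fix : ∀ i, i ∉ W → π i = i
  /-- the position wires are the graph of `π` on the window -/
  pos_iff : ∀ u ∈ W, ∀ j ∈ W, wval x (P.sem x) (R.pos ℓ u j) = true ↔ π u = j

/-- A permutation fixing the complement of `W` maps `W` to `W`. [folklore] -/
theorem Encodes.mem_iff {R : P.Readout L W} {x : Fin m × Fin m → Bool} {ℓ : L}
    {π : Equiv.Perm (Fin m)} (h : R.Encodes x ℓ π) (u : Fin m) : π u ∈ W ↔ u ∈ W := by
  constructor
  · intro hu
    by_contra hu'
    rw [h.fix u hu'] at hu
    exact hu' hu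
  · intro hu
    by_contra hπu
    have h1 : π (π u) = π u := h.fix _ hπu
    have h2 : π u = u := π.injective h1
    rw [h2] at hπu
    exact hπu hu

/-- … and so does its inverse. [folklore] -/
theorem Encodes.symm_mem_iff {R : P.Readout L W} {x : Fin m × Fin m → Bool} {ℓ : L}
    {π : Equiv.Perm (Fin m)} (h : R.Encodes x ℓ π) (a : Fin m) : π.symm a ∈ W ↔ a ∈ W := by
  conv_rhs => rw [← π.apply_symm_apply a]
  exact (h.mem_iff _).symm

/-- The inverse also fixes the complement of `W`. [folklore] -/
theorem Encodes.symm_fix {R : P.Readout L W} {x : Fin m × Fin m → Bool} {ℓ : L}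
    {π : Equiv.Perm (Fin m)} (h : R.Encodes x ℓ π) (a : Fin m) (ha : a ∉ W) : π.symm a = a := by
  have := h.fix a ha
  conv_lhs => rw [← this]
  exact π.symm_apply_apply a

/-- `cell`. [folklore] -/
theorem sem_cell (ℓ : L) (u v a b : Fin m) :
    P.sem x (R.cell ℓ u v a b) = true ↔ x (u, v) = true ∧
      (a ∈ W → wval x (P.sem x) (R.pos ℓ u a) = true) ∧ (b ∈ W → wval x (P.sem x) (R.pos ℓ v b) = true) := by
  rw [P.sem_and (R.kind_cell ℓ u v a b), R.srcs_cell]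
  simp only [mem_insert, mem_union, forall_eq_or_imp, wval_inl]
  refine and_congr_right fun _ => ?_
  constructor
  · intro h
    refine ⟨fun ha => h _ (Or.inl ?_), fun hb => h _ (Or.inr ?_)⟩
    · rw [if_pos ha]; exact mem_singleton_self _
    · rw [if_pos hb]; exact mem_singleton_self _
  · rintro ⟨ha, hb⟩ w (hw | hw)
    · split_ifs at hw with h
      · rw [mem_singleton] at hw; subst hw; exact ha h
      · exact absurd hw (Finset.notMem_empty _)
    · split_ifs at hw with h
      · rw [mem_singleton] at hw; subst hw; exact hb h
      · exact absurd hw (Finset.notMem_empty _)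

/-- `entry`, raw form. [folklore] -/
theorem sem_entry (ℓ : L) (a b : Fin m) :
    P.sem x (R.entry ℓ a b) = true ↔
      ∃ u ∈ cand W a, ∃ v ∈ cand W b, P.sem x (R.cell ℓ u v a b) = true := by
  rw [P.sem_or (R.kind_entry ℓ a b), R.srcs_entry]
  simp only [mem_image, mem_product, Prod.exists]
  constructor
  · rintro ⟨_, ⟨u, v, ⟨hu, hv⟩, rfl⟩, h⟩; exact ⟨u, hu, v, hv, h⟩
  · rintro ⟨u, hu, v, hv, h⟩; exact ⟨_, ⟨u, v, ⟨hu, hv⟩, rfl⟩, h⟩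

/-- The matching condition at one position singles out `π⁻¹ a`. [folklore] -/
theorem match_iff {ℓ : L} {π : Equiv.Perm (Fin m)} (h : R.Encodes x ℓ π) (a u : Fin m)
    (hu : u ∈ cand W a) : (a ∈ W → wval x (P.sem x) (R.pos ℓ u a) = true) ↔ u = π.symm a := by
  rw [mem_cand_iff] at hu
  rcases hu with ⟨ha, huW⟩ | ⟨ha, rfl⟩
  · rw [h.pos_iff u huW a ha]
    simp only [ha, forall_const]
    constructor
    · intro hπ; rw [← hπ, Equiv.symm_apply_apply]
    · intro hu; rw [hu, Equiv.apply_symm_apply]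
  · simp only [ha, IsEmpty.forall_iff, true_iff]
    exact (h.symm_fix u ha).symm

/-- **The readout is the relabelled matrix**: if the position wires of `ℓ` encode `π`, the entry
`(a, b)` carries `x (π⁻¹ a, π⁻¹ b)`. [folklore] -/
theorem sem_entry_of_encodes {ℓ : L} {π : Equiv.Perm (Fin m)} (h : R.Encodes x ℓ π) (a b : Fin m) :
    P.sem x (R.entry ℓ a b) = x (π.symm a, π.symm b) := by
  rw [Bool.eq_iff_iff, R.sem_entry]
  constructor
  · rintro ⟨u, hu, v, hv, hc⟩
    rw [R.sem_cell] at hc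
    obtain ⟨hx, ha, hb⟩ := hc
    rw [(R.match_iff x h a u hu).1 ha, (R.match_iff x h b v hv).1 hb] at hx
    exact hx
  · intro hx
    have hua : π.symm a ∈ cand W a := by
      rw [mem_cand_iff]
      by_cases ha : a ∈ W
      · exact Or.inl ⟨ha, (h.symm_mem_iff a).2 ha⟩
      · exact Or.inr ⟨ha, h.symm_fix a ha⟩
    have hvb : π.symm b ∈ cand W b := by
      rw [mem_cand_iff]
      by_cases hb : b ∈ W
      · exact Or.inl ⟨hb, (h.symm_mem_iff b).2 hb⟩
      · exact Or.inr ⟨hb, h.symm_fix b hb⟩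
    refine ⟨π.symm a, hua, π.symm b, hvb, ?_⟩
    rw [R.sem_cell]
    exact ⟨hx, (R.match_iff x h a _ hua).2 rfl, (R.match_iff x h b _ hvb).2 rfl⟩

/-- The same with the relabelling written as a function on pairs. [folklore] -/
theorem sem_entry_eq_comp {ℓ : L} {π : Equiv.Perm (Fin m)} (h : R.Encodes x ℓ π) :
    (fun ab : Fin m × Fin m => P.sem x (R.entry ℓ ab.1 ab.2)) =
      fun ab => x (π.symm ab.1, π.symm ab.2) :=
  funext fun ab => R.sem_entry_of_encodes x h ab.1 ab.2

end Readout

end SymProg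

end Literature.Computability.Complexity
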